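import Mathlib
import HarnessLib
import HarnessLib.Audit
import Summits.QuantumFields.QCD.Theses.PauliWegnerSea
import Summits.QuantumFields.QCD.Theses.WilsonMobilityGap
import Literature.MathematicalPhysics.QuantumFieldTheory.QCDPhaseQuenchedMomentUpgrade
import Literature.MathematicalPhysics.QuantumFieldTheory.FermiFlavourPhase

/-!
# Line `crossing-split-integrability` — LEAD'S SKELETON (reshaped r1 by prover-line-stmt-QuantumFields-9151-0)
# for crux `PauliWegnerSea.PhaseQuenchedFlavourDecay` (stmt-QuantumFields-9151; byte-identical to
# `WilsonMobilityGap.PhaseQuenchedFlavourDecay`; the composition concludes BOTH copies by name)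

Crux (fixed): `∀ Nf reg m > 0, Upper → Conc` (`crux_iff := Iff.rfl`).

Idea (card `Ideas/crossing-split-integrability.md`, planner skeleton `Lines/crossing-split-integrability.lean`,
triage r1-1/2/3 pass): DECAY IS FREE.  Wick's theorem turns the phase-quenched correlator into finitely many
`r × r` minors of the full flavour-block-diagonal propagator `G = (diracMatrix U mq)⁻¹`; flavour charge forces
`≥ |q|` CROSSING entries; split on the size of the crossing entries (rare by `Upper` + Markov + torus
translation), Laplace-expand by crossing matchings off the rare event, interpolate below the integrability
edge; the ONE open input is `MinorMoments` (r-uniform `(1+ε)`-moments of all Wick minors, `stub_apriori`).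

RESHAPE (lead, 2026-08-16).  The planner's 5 stubs become 7 (= stubs_max), with the SAME composition idea:
* `stub_decayTransfer` (planner: Markov/translation transport + split, L) is cut into
  `stub_twoPoint` (M: `Upper` transported from the base point `0` to an arbitrary torus site by torus
  translation invariance of the phase-quenched measure — the only place `wilsonMeasure_map_torusConfigShift`
  is needed) and `stub_decayTransfer` (L: the crossing split proper, consuming `TwoPointDecay` instead of
  `Upper`);
* `stub_wick` (planner: Grassmann bookkeeping + summation, L) is cut into `stub_wickExpansion`
  (L, DETERMINISTIC: for flavour-charged `A` the Berezin ratio `⟨A(0)B(n e₀)⟩_F(U)` is bounded, for every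
  torus, separation, mass vector and gauge field, by a FIXED finite combination of norms of charged two-box
  Wick minors — Grassmann basis expansion, `QCDLatticeObservable.bounded`, charge selection rule, Wick in
  determinant form) and `stub_wickSum` (M: that bound + `MinorDecay` ⇒ `Conc`, pure measure theory:
  `norm_integral_le_of_norm_le`, finitely many `∀ᶠ` sets);
* EVERY stub signature is stated over TREE VOCABULARY ONLY (`diracMatrix`, `quarkEquiv`, `qcdLatticeMeasure`,
  `qcdPhaseQuenchedExpect`, `QCDLatticeObservable.onTorus/.IsFlavourCharged`, `fermiIntegral`, `fermiBoltzmann`,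
  `Torus.proj`, `box`, `BoxQuarkVar` + Mathlib): the line's local definitions (`bareMass`, `wickMinor`, `place`,
  `chargeA`, `MinorMoments`, `MinorDecay`, `TwoPointDecay`, `WickBound`, `Upper`, `Conc`) are kept below as
  readable ABBREVIATIONS of exactly those inlined texts, so that (i) each stub's file under `Theorems/` states
  the registered signature literally and definition-free, (ii) the final crux file is a pure proof.

Stubs (7): `stub_splitBound` (S/M) · `stub_crossingLaplace` (M) · `stub_apriori` (XL, HARDEST, lead) ·
`stub_twoPoint` (M) · `stub_decayTransfer` (L) · `stub_wickExpansion` (L) · `stub_wickSum` (M).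

Disproof.lean (cdisprove v1–v5; file not mounted in this jail, read through its evidence notes) honoured:
`_false_without_upper` — `Upper` is consumed by `stub_twoPoint` (→ `stub_decayTransfer`, Markov on crossing
entries) and guards `stub_apriori`; `_false_without_charge` / `_false_without_qNeZero` — the charge enters once,
as the non-zero A-side charge of every term produced by `stub_wickExpansion` and consumed by
`stub_decayTransfer` through `stub_crossingLaplace` (`q = 0` would give `η⁰ = 1`, no decay);
`phaseQuenchedFlavourDecay_iff_bare` — `m > 0` is a pass-through binder; whyItResists §4 / (f) — `MinorMoments`
IS the local Wegner-type anti-concentration, in r-uniform `(1+ε)`-moment form.  No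
`Theorems/PhaseQuenchedFlavourDecay/Negative/` lemma exists (nothing to import).
-/

noncomputable section

namespace Summit.QuantumFields.QCD.Cruxes.PhaseQuenchedFlavourDecay.CrossingSplitIntegrability

open scoped BigOperators
open MeasureTheory Filter
open Literature.MathematicalPhysics.QuantumFieldTheory Literature.MathematicalPhysics.QuantumLattice
  Literature.Probability.LatticeModels

/-! ## The crux, factored verbatim as `Upper → Conc` -/

/-- The crux's hypothesis UPPER (= clause (ii) of `MobilityGap`), verbatim. -/
def Upper (Nf : ℕ) (reg : QCDRegularisation Nf) (m : Fin Nf → ℝ) : Prop :=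
  ∃ s δ C : ℝ, 0 < s ∧ s < 1 ∧ 0 < δ ∧ ∀ᶠ k in atTop, ∀ S : ℕ, reg.L k ≤ S → ∀ (f : Fin Nf) (v : Literature.Probability.LatticeModels.Site 4), v ∈ box 4 S → (∫ U : GaugeConfig 4 (2 * S + 1) (Matrix.specialUnitaryGroup (Fin 3) ℂ), ‖(diracMatrix U fun fl => reg.mcrit k + reg.a k * m fl / reg.Zm k).det‖ * (∑ a : Fin 3, ∑ i : Fin 4, ∑ b : Fin 3, ∑ j : Fin 4, ‖(diracMatrix U fun fl => reg.mcrit k + reg.a k * m fl / reg.Zm k)⁻¹ (quarkEquiv (f, (Torus.proj (2 * S + 1) 0, a, i))) (quarkEquiv (f, (Torus.proj (2 * S + 1) (v), b, j)))‖) ^ s ∂(wilsonMeasure (fundamentalRep (Fin 3)) (reg.β k))) / (∫ U : GaugeConfig 4 (2 * S + 1) (Matrix.specialUnitaryGroup (Fin 3) ℂ), ‖(diracMatrix U fun fl => reg.mcrit k + reg.a k * m fl / reg.Zm k).det‖ ∂(wilsonMeasure (fundamentalRep (Fin 3)) (reg.β k))) ≤ C * Real.exp (-(δ * (reg.a k *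 ‖v‖)))

/-- The crux's conclusion CONC, verbatim. -/
def Conc (Nf : ℕ) (reg : QCDRegularisation Nf) (m : Fin Nf → ℝ) : Prop :=
  ∃ δ' : ℝ, 0 < δ' ∧ ∀ (R R' : ℕ) (A : QCDLatticeObservable Nf R) (B : QCDLatticeObservable Nf R'), (∃ (f₀ : Fin Nf) (q : ℤ), q ≠ 0 ∧ ∀ (θ : ℝ) (U : LGConfig 4 (Matrix.specialUnitaryGroup (Fin 3) ℂ)), ExteriorAlgebra.map (LinearMap.pi fun w => (Sum.elim (fun i => if (boxQuarkEquiv.symm i).1 = f₀ then Complex.exp (-((θ : ℂ) * Complex.I)) else 1) (fun i => if (boxQuarkEquiv.symm i).1 = f₀ then Complex.exp ((θ : ℂ) * Complex.I) else 1) (ofLex w)) • LinearMap.proj w) (A.F U) = Complex.exp (((q : ℝ) * θ : ℝ) * Complex.I) • A.F U) → ∃ C' : ℝ, ∀ᶠ k in atTop, ∀ S : ℕ, reg.L k ≤ S → ∀ n : ℕ, n ≤ S → ‖(∫ U : GaugeConfig 4 (2 * S + 1) (Matrix.specialUnitaryGroup (Fin 3) ℂ), (‖(diracMatrix U fun fl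 => reg.mcrit k + reg.a k * m fl / reg.Zm k).det‖ : ℂ) * (fermiIntegral (A.onTorus (2 * S + 1) 0 U * B.onTorus (2 * S + 1) (Pi.single 0 (n : ℤ)) U * fermiBoltzmann U fun fl => reg.mcrit k + reg.a k * m fl / reg.Zm k) / fermiIntegral (fermiBoltzmann U fun fl => reg.mcrit k + reg.a k * m fl / reg.Zm k)) ∂(wilsonMeasure (fundamentalRep (Fin 3)) (reg.β k))) / (∫ U : GaugeConfig 4 (2 * S + 1) (Matrix.specialUnitaryGroup (Fin 3) ℂ), (‖(diracMatrix U fun fl => reg.mcrit k + reg.a k * m fl / reg.Zm k).det‖ : ℂ) ∂(wilsonMeasure (fundamentalRep (Fin 3)) (reg.β k)))‖ ≤ C' * Real.exp (-(δ' * (reg.a k * n)))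

/-- The crux is literally `∀ Nf reg m > 0, Upper → Conc`. -/
theorem crux_iff :
    Summit.QuantumFields.QCD.Theses.PauliWegnerSea.PhaseQuenchedFlavourDecay ↔
      ∀ (Nf : ℕ) (reg : QCDRegularisation Nf) (m : Fin Nf → ℝ), (∀ f, 0 < m f) →
        Upper Nf reg m → Conc Nf reg m :=
  Iff.rfl

/-- The sibling route's copy of the crux is the same proposition. -/
theorem crux_iff_wilsonMobilityGap :
    Summit.QuantumFields.QCD.Theses.WilsonMobilityGap.PhaseQuenchedFlavourDecay ↔
      ∀ (Nf : ℕ) (reg : QCDRegularisation Nf) (m : Fin Nf → ℝ), (∀ f, 0 < m f) →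
        Upper Nf reg m → Conc Nf reg m :=
  Iff.rfl

/-! ## Vocabulary of the line (ABBREVIATIONS; every stub below inlines them) -/

/-- Bare Wilson masses at step `k`: `m_f(k) = m_crit(k) + a_k m_f / Z_m(k)` (the crux's lambda). -/
def bareMass {Nf : ℕ} (reg : QCDRegularisation Nf) (m : Fin Nf → ℝ) (k : ℕ) : Fin Nf → ℝ :=
  fun fl => reg.mcrit k + reg.a k * m fl / reg.Zm k

/-- The `r × r` WICK MINOR `det [G(I a, J b)]_{a,b}` of the full quark propagator `G = (diracMatrix U mq)⁻¹`
(rows = `ψ`-indices `I`, columns = `ψ̄`-indices `J`; QuarkVar-indexed, hence jointly over flavours). -/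
def wickMinor {Nf N : ℕ} [NeZero N] {r : ℕ} (I J : Fin r → QuarkVar Nf N) (mq : Fin Nf → ℝ)
    (U : GaugeConfig 4 N SU3) : ℂ :=
  (Matrix.of fun a b : Fin r => (diracMatrix U mq)⁻¹ (quarkEquiv (I a)) (quarkEquiv (J b))).det

/-- Quark variables of the two observables: `A`'s box (radius `R`, left, placed at `0`) and `B`'s box
(radius `R'`, right, placed at `n e₀`). -/
abbrev TwoBoxVar (Nf R R' : ℕ) : Type := BoxQuarkVar Nf R ⊕ BoxQuarkVar Nf R'

/-- Placement on the torus of side `2S+1`: `A`-variables at `x mod (2S+1)`, `B`-variables at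
`x + n e₀ mod (2S+1)` (as `QCDLatticeObservable.onTorus` / `toTorusIdx`, up to `x + 0 = x`). -/
def place {Nf R R' : ℕ} (S n : ℕ) : TwoBoxVar Nf R R' → QuarkVar Nf (2 * S + 1) :=
  Sum.elim
    (fun v : BoxQuarkVar Nf R =>
      (v.1, (Torus.proj (2 * S + 1) (v.2.1 : Literature.Probability.LatticeModels.Site 4), v.2.2)))
    (fun v : BoxQuarkVar Nf R' =>
      (v.1, (Torus.proj (2 * S + 1)
        ((v.2.1 : Literature.Probability.LatticeModels.Site 4) + Pi.single 0 (n : ℤ)), v.2.2)))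

/-- The `U(1)_{f₀}` charge carried by the `A`-side of a Wick term: `#(A-side ψ_{f₀} rows) − #(A-side ψ̄_{f₀}
columns)`. -/
def chargeA {Nf R R' r : ℕ} (f₀ : Fin Nf) (κ ρ : Fin r → TwoBoxVar Nf R R') : ℤ :=
  ((Finset.univ.filter fun a => Sum.isLeft (κ a) = true ∧
      Sum.elim (fun v : BoxQuarkVar Nf R => v.1) (fun v : BoxQuarkVar Nf R' => v.1) (κ a) = f₀).card : ℤ) -
    ((Finset.univ.filter fun b => Sum.isLeft (ρ b) = true ∧
      Sum.elim (fun v : BoxQuarkVar Nf R => v.1) (fun v : BoxQuarkVar Nf R' => v.1) (ρ b) = f₀).card : ℤ)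

/-! ## Stub statements -/

/-- **SplitBound** (Mathlib-only; two Hölders + Markov). -/
def SplitBound : Prop :=
  ∀ (Ω : Type) [MeasurableSpace Ω] (ν : Measure Ω) [IsProbabilityMeasure ν] (X Y G : Ω → ℝ) (ε η : ℝ) (q : ℕ),
    0 < ε → 0 < η → η ≤ 1 → (∀ ω, 0 ≤ X ω) → (∀ ω, 0 ≤ Y ω) → Measurable X → Measurable Y → Measurable G →
    Integrable (fun ω => X ω ^ (1 + ε)) ν → Integrable (fun ω => Real.sqrt (Y ω)) ν →
    (∀ ω, G ω ≤ η → X ω ≤ η ^ q * Y ω) →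
      ∫ ω, X ω ∂ν ≤
        (∫ ω, X ω ^ (1 + ε) ∂ν) ^ (1 / (1 + ε)) * (ν {ω | η < G ω}).toReal ^ (ε / (1 + ε)) +
          η ^ ((q : ℝ) * ε / (1 + 2 * ε)) * (∫ ω, Real.sqrt (Y ω) ∂ν) ^ (2 * ε / (1 + 2 * ε)) *
            (∫ ω, X ω ^ (1 + ε) ∂ν) ^ (1 / (1 + 2 * ε))

/-- **CrossingLaplace** (Mathlib-only; generalised Laplace expansion by crossing matchings). -/
def CrossingLaplace : Prop :=
  ∀ r : ℕ, ∃ K : ℝ, 0 ≤ K ∧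
    ∀ (Φ : Type) [DecidableEq Φ] (M : Matrix (Fin r) (Fin r) ℂ) (φr φc : Fin r → Φ) (sr sc : Fin r → Bool)
      (f₀ : Φ) (η : ℝ), 0 ≤ η → η ≤ 1 →
      (∀ a b, φr a ≠ φc b → M a b = 0) →
      (∀ a b, sr a ≠ sc b → ‖M a b‖ ≤ η) →
        ‖M.det‖ ≤
          η ^ (((Finset.univ.filter fun a => φr a = f₀ ∧ sr a = true).card : ℤ) -
                ((Finset.univ.filter fun b => φc b = f₀ ∧ sc b = true).card : ℤ)).natAbs * K *
            ∑ i : Fin (r + 1), ∑ j : Fin (r + 1),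
              ∑ e₁ : Fin (i : ℕ) → {a // sr a = true}, ∑ e₂ : Fin (i : ℕ) → {b // sc b = true},
                ∑ e₃ : Fin (j : ℕ) → {a // sr a = false}, ∑ e₄ : Fin (j : ℕ) → {b // sc b = false},
                  ‖(M.submatrix (fun t => (e₁ t).1) (fun t => (e₂ t).1)).det‖ *
                    ‖(M.submatrix (fun t => (e₃ t).1) (fun t => (e₄ t).1)).det‖

/-- **MinorMoments** — volume-uniform phase-quenched `(1+ε)`-th moments of ALL `r × r` Wick minors of the
full propagator, ONE `ε` before `r` (the open core's target). -/
def MinorMoments (Nf : ℕ) (reg : QCDRegularisation Nf) (m : Fin Nf → ℝ) : Prop :=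
  ∃ ε : ℝ, 0 < ε ∧ ∀ r : ℕ, ∃ C : ℝ, ∀ᶠ k in atTop, ∀ S : ℕ, reg.L k ≤ S →
    ∀ I J : Fin r → QuarkVar Nf (2 * S + 1),
      Integrable (fun U : GaugeConfig 4 (2 * S + 1) SU3 =>
          ‖(Matrix.of fun a b : Fin r => (diracMatrix U fun fl => reg.mcrit k + reg.a k * m fl / reg.Zm k)⁻¹
            (quarkEquiv (I a)) (quarkEquiv (J b))).det‖ ^ (1 + ε))
          (qcdLatticeMeasure (2 * S + 1) (reg.β k) fun fl => reg.mcrit k + reg.a k * m fl / reg.Zm k) ∧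
        qcdPhaseQuenchedExpect (reg.β k) (2 * S + 1) (fun fl => reg.mcrit k + reg.a k * m fl / reg.Zm k)
            (fun U : GaugeConfig 4 (2 * S + 1) SU3 =>
              ‖(Matrix.of fun a b : Fin r => (diracMatrix U fun fl => reg.mcrit k + reg.a k * m fl / reg.Zm k)⁻¹
                (quarkEquiv (I a)) (quarkEquiv (J b))).det‖ ^ (1 + ε)) ≤ C

/-- **TwoPointDecay** — `Upper` transported to an arbitrary base site `x` of the torus (torus translation
invariance of the phase-quenched measure), in `qcdPhaseQuenchedExpect` form, with the integrability of the
`s`-th power of the colour–spin entry sum under `qcdLatticeMeasure`. -/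
def TwoPointDecay (Nf : ℕ) (reg : QCDRegularisation Nf) (m : Fin Nf → ℝ) : Prop :=
  ∃ s δ C : ℝ, 0 < s ∧ s < 1 ∧ 0 < δ ∧ ∀ᶠ k in atTop, ∀ S : ℕ, reg.L k ≤ S →
    ∀ (f : Fin Nf) (x : TorusSite 4 (2 * S + 1)) (v : Literature.Probability.LatticeModels.Site 4), v ∈ box 4 S →
      Integrable (fun U : GaugeConfig 4 (2 * S + 1) SU3 =>
          (∑ a : Fin 3, ∑ i : Fin 4, ∑ b : Fin 3, ∑ j : Fin 4,
            ‖(diracMatrix U fun fl => reg.mcrit k + reg.a k * m fl / reg.Zm k)⁻¹ (quarkEquiv (f, (x, a, i)))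
              (quarkEquiv (f, (x + Torus.proj (2 * S + 1) v, b, j)))‖) ^ s)
          (qcdLatticeMeasure (2 * S + 1) (reg.β k) fun fl => reg.mcrit k + reg.a k * m fl / reg.Zm k) ∧
        qcdPhaseQuenchedExpect (reg.β k) (2 * S + 1) (fun fl => reg.mcrit k + reg.a k * m fl / reg.Zm k)
            (fun U : GaugeConfig 4 (2 * S + 1) SU3 =>
              (∑ a : Fin 3, ∑ i : Fin 4, ∑ b : Fin 3, ∑ j : Fin 4,
                ‖(diracMatrix U fun fl => reg.mcrit k + reg.a k * m fl / reg.Zm k)⁻¹ (quarkEquiv (f, (x, a, i)))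
                  (quarkEquiv (f, (x + Torus.proj (2 * S + 1) v, b, j)))‖) ^ s) ≤
          C * Real.exp (-(δ * (reg.a k * ‖v‖)))

/-- **MinorDecay** — ONE rate `δ' > 0` for the phase-quenched FIRST moments of all two-box Wick minors whose
`A`-side carries non-zero `U(1)_{f₀}` charge (plus integrability). -/
def MinorDecay (Nf : ℕ) (reg : QCDRegularisation Nf) (m : Fin Nf → ℝ) : Prop :=
  ∃ δ' : ℝ, 0 < δ' ∧ ∀ r R R' : ℕ, ∃ C : ℝ, ∀ᶠ k in atTop, ∀ S : ℕ, reg.L k ≤ S → ∀ n : ℕ, n ≤ S →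
    ∀ (κ ρ : Fin r → BoxQuarkVar Nf R ⊕ BoxQuarkVar Nf R') (f₀ : Fin Nf),
      ((Finset.univ.filter fun a => Sum.isLeft (κ a) = true ∧
          Sum.elim (fun v : BoxQuarkVar Nf R => v.1) (fun v : BoxQuarkVar Nf R' => v.1) (κ a) = f₀).card : ℤ) -
        ((Finset.univ.filter fun b => Sum.isLeft (ρ b) = true ∧
          Sum.elim (fun v : BoxQuarkVar Nf R => v.1) (fun v : BoxQuarkVar Nf R' => v.1) (ρ b) = f₀).card : ℤ) ≠ 0 →
      Integrable (fun U : GaugeConfig 4 (2 * S + 1) SU3 =>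
          ‖(Matrix.of fun a b : Fin r => (diracMatrix U fun fl => reg.mcrit k + reg.a k * m fl / reg.Zm k)⁻¹
            (quarkEquiv (Sum.elim
              (fun v : BoxQuarkVar Nf R =>
                (v.1, (Torus.proj (2 * S + 1) (v.2.1 : Literature.Probability.LatticeModels.Site 4), v.2.2)))
              (fun v : BoxQuarkVar Nf R' =>
                (v.1, (Torus.proj (2 * S + 1)
                  ((v.2.1 : Literature.Probability.LatticeModels.Site 4) + Pi.single 0 (n : ℤ)), v.2.2)))
              (κ a)))
            (quarkEquiv (Sum.elim
              (fun v : BoxQuarkVar Nf R =>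
                (v.1, (Torus.proj (2 * S + 1) (v.2.1 : Literature.Probability.LatticeModels.Site 4), v.2.2)))
              (fun v : BoxQuarkVar Nf R' =>
                (v.1, (Torus.proj (2 * S + 1)
                  ((v.2.1 : Literature.Probability.LatticeModels.Site 4) + Pi.single 0 (n : ℤ)), v.2.2)))
              (ρ b)))).det‖)
          (qcdLatticeMeasure (2 * S + 1) (reg.β k) fun fl => reg.mcrit k + reg.a k * m fl / reg.Zm k) ∧
        qcdPhaseQuenchedExpect (reg.β k) (2 * S + 1) (fun fl => reg.mcrit k + reg.a k * m fl / reg.Zm k)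
            (fun U : GaugeConfig 4 (2 * S + 1) SU3 =>
              ‖(Matrix.of fun a b : Fin r => (diracMatrix U fun fl => reg.mcrit k + reg.a k * m fl / reg.Zm k)⁻¹
                (quarkEquiv (Sum.elim
                  (fun v : BoxQuarkVar Nf R =>
                    (v.1, (Torus.proj (2 * S + 1) (v.2.1 : Literature.Probability.LatticeModels.Site 4), v.2.2)))
                  (fun v : BoxQuarkVar Nf R' =>
                    (v.1, (Torus.proj (2 * S + 1)
                      ((v.2.1 : Literature.Probability.LatticeModels.Site 4) + Pi.single 0 (n : ℤ)), v.2.2)))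
                  (κ a)))
                (quarkEquiv (Sum.elim
                  (fun v : BoxQuarkVar Nf R =>
                    (v.1, (Torus.proj (2 * S + 1) (v.2.1 : Literature.Probability.LatticeModels.Site 4), v.2.2)))
                  (fun v : BoxQuarkVar Nf R' =>
                    (v.1, (Torus.proj (2 * S + 1)
                      ((v.2.1 : Literature.Probability.LatticeModels.Site 4) + Pi.single 0 (n : ℤ)), v.2.2)))
                  (ρ b)))).det‖) ≤
          C * Real.exp (-(δ' * (reg.a k * n)))

/-- **WickBound** — the deterministic output of Wick's theorem in determinant form for a flavour-charged `A`:
a FIXED finite family of charged two-box index pairs with non-negative weights bounding the Berezin ratio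
`⟨A(0)B(n e₀)⟩_F(U)` on every torus, for every separation, mass vector and gauge field. -/
def WickBound (Nf : ℕ) : Prop :=
  ∀ (R R' : ℕ) (A : QCDLatticeObservable Nf R) (B : QCDLatticeObservable Nf R') (f₀ : Fin Nf) (q : ℤ),
    q ≠ 0 → A.IsFlavourCharged f₀ q →
    ∃ (ι : Type) (_ : Fintype ι) (r : ι → ℕ) (κ : (i : ι) → Fin (r i) → BoxQuarkVar Nf R ⊕ BoxQuarkVar Nf R')
      (ρ : (i : ι) → Fin (r i) → BoxQuarkVar Nf R ⊕ BoxQuarkVar Nf R') (c : ι → ℝ),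
      (∀ i, 0 ≤ c i) ∧
      (∀ i, ((Finset.univ.filter fun a => Sum.isLeft (κ i a) = true ∧
          Sum.elim (fun v : BoxQuarkVar Nf R => v.1) (fun v : BoxQuarkVar Nf R' => v.1) (κ i a) = f₀).card : ℤ) -
        ((Finset.univ.filter fun b => Sum.isLeft (ρ i b) = true ∧
          Sum.elim (fun v : BoxQuarkVar Nf R => v.1) (fun v : BoxQuarkVar Nf R' => v.1) (ρ i b) = f₀).card : ℤ) ≠ 0) ∧
      ∀ (S n : ℕ) (mq : Fin Nf → ℝ) (U : GaugeConfig 4 (2 * S + 1) SU3),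
        ‖fermiIntegral (A.onTorus (2 * S + 1) 0 U * B.onTorus (2 * S + 1) (Pi.single 0 (n : ℤ)) U *
              fermiBoltzmann U mq) / fermiIntegral (fermiBoltzmann U mq)‖ ≤
          ∑ i, c i * ‖(Matrix.of fun a b : Fin (r i) => (diracMatrix U mq)⁻¹
            (quarkEquiv (Sum.elim
              (fun v : BoxQuarkVar Nf R =>
                (v.1, (Torus.proj (2 * S + 1) (v.2.1 : Literature.Probability.LatticeModels.Site 4), v.2.2)))
              (fun v : BoxQuarkVar Nf R' =>
                (v.1, (Torus.proj (2 * S + 1)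
                  ((v.2.1 : Literature.Probability.LatticeModels.Site 4) + Pi.single 0 (n : ℤ)), v.2.2)))
              (κ i a)))
            (quarkEquiv (Sum.elim
              (fun v : BoxQuarkVar Nf R =>
                (v.1, (Torus.proj (2 * S + 1) (v.2.1 : Literature.Probability.LatticeModels.Site 4), v.2.2)))
              (fun v : BoxQuarkVar Nf R' =>
                (v.1, (Torus.proj (2 * S + 1)
                  ((v.2.1 : Literature.Probability.LatticeModels.Site 4) + Pi.single 0 (n : ℤ)), v.2.2)))
              (ρ i b)))).det‖

/-! ## Sanity: the abbreviations agree with the inlined texts -/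

example {Nf R R' : ℕ} (S n : ℕ) (x : TwoBoxVar Nf R R') :
    place S n x = Sum.elim
      (fun v : BoxQuarkVar Nf R =>
        (v.1, (Torus.proj (2 * S + 1) (v.2.1 : Literature.Probability.LatticeModels.Site 4), v.2.2)))
      (fun v : BoxQuarkVar Nf R' =>
        (v.1, (Torus.proj (2 * S + 1)
          ((v.2.1 : Literature.Probability.LatticeModels.Site 4) + Pi.single 0 (n : ℤ)), v.2.2))) x := rfl

example {Nf N r : ℕ} [NeZero N] (I J : Fin r → QuarkVar Nf N) (mq : Fin Nf → ℝ) (U : GaugeConfig 4 N SU3) :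
    wickMinor I J mq U =
      (Matrix.of fun a b : Fin r => (diracMatrix U mq)⁻¹ (quarkEquiv (I a)) (quarkEquiv (J b))).det := rfl

/-! ## Obligation aliases (name-keyed, for the skeleton audit) -/

namespace Obligation

/-- = `SplitBound`. -/
abbrev stub_splitBound : Prop := SplitBound
/-- = `CrossingLaplace`. -/
abbrev stub_crossingLaplace : Prop := CrossingLaplace
/-- = `∀ Nf reg m > 0, Upper → MinorMoments`. -/
abbrev stub_apriori : Prop :=
  ∀ (Nf : ℕ) (reg : QCDRegularisation Nf) (m : Fin Nf → ℝ), (∀ f, 0 < m f) →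
    Upper Nf reg m → MinorMoments Nf reg m
/-- = `∀ Nf reg m, Upper → TwoPointDecay`. -/
abbrev stub_twoPoint : Prop :=
  ∀ (Nf : ℕ) (reg : QCDRegularisation Nf) (m : Fin Nf → ℝ), Upper Nf reg m → TwoPointDecay Nf reg m
/-- = `SplitBound → CrossingLaplace → ∀ Nf reg m, TwoPointDecay → MinorMoments → MinorDecay`. -/
abbrev stub_decayTransfer : Prop :=
  SplitBound → CrossingLaplace →
    ∀ (Nf : ℕ) (reg : QCDRegularisation Nf) (m : Fin Nf → ℝ),
      TwoPointDecay Nf reg m → MinorMoments Nf reg m → MinorDecay Nf reg m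
/-- = `∀ Nf, WickBound Nf`. -/
abbrev stub_wickExpansion : Prop := ∀ Nf : ℕ, WickBound Nf
/-- = `(∀ Nf, WickBound Nf) → ∀ Nf reg m, MinorDecay → Conc`. -/
abbrev stub_wickSum : Prop :=
  (∀ Nf : ℕ, WickBound Nf) →
    ∀ (Nf : ℕ) (reg : QCDRegularisation Nf) (m : Fin Nf → ℝ), MinorDecay Nf reg m → Conc Nf reg m

end Obligation

/-! ## Kernel-checked composition (no `sorry` here) -/

/-- **Composition.** The seven stub statements imply the crux BY NAME. -/
theorem PhaseQuenchedFlavourDecay_of :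
    Obligation.stub_splitBound → Obligation.stub_crossingLaplace → Obligation.stub_apriori →
      Obligation.stub_twoPoint → Obligation.stub_decayTransfer → Obligation.stub_wickExpansion →
        Obligation.stub_wickSum →
          Summit.QuantumFields.QCD.Theses.PauliWegnerSea.PhaseQuenchedFlavourDecay := by
  intro hS hL hA hP hT hE hW
  rw [crux_iff]
  intro Nf reg m hm hU
  exact hW hE Nf reg m (hT hS hL Nf reg m (hP Nf reg m hU) (hA Nf reg m hm hU))

/-- The same composition for the sibling route's byte-identical copy of the crux. -/
theorem PhaseQuenchedFlavourDecay_of_wilsonMobilityGap :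
    Obligation.stub_splitBound → Obligation.stub_crossingLaplace → Obligation.stub_apriori →
      Obligation.stub_twoPoint → Obligation.stub_decayTransfer → Obligation.stub_wickExpansion →
        Obligation.stub_wickSum →
          Summit.QuantumFields.QCD.Theses.WilsonMobilityGap.PhaseQuenchedFlavourDecay := by
  intro hS hL hA hP hT hE hW
  rw [crux_iff_wilsonMobilityGap]
  intro Nf reg m hm hU
  exact hW hE Nf reg m (hT hS hL Nf reg m (hP Nf reg m hU) (hA Nf reg m hm hU))

/-! ## Registered stubs (signatures in TREE VOCABULARY ONLY; `sorry` only here) -/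

/-- stub 1 `stub_splitBound` (S/M, provable now; Mathlib-only): two Hölder inequalities + Markov. -/
theorem stub_splitBound :
    ∀ (Ω : Type) [MeasurableSpace Ω] (ν : Measure Ω) [IsProbabilityMeasure ν] (X Y G : Ω → ℝ) (ε η : ℝ) (q : ℕ),
      0 < ε → 0 < η → η ≤ 1 → (∀ ω, 0 ≤ X ω) → (∀ ω, 0 ≤ Y ω) → Measurable X → Measurable Y → Measurable G →
      Integrable (fun ω => X ω ^ (1 + ε)) ν → Integrable (fun ω => Real.sqrt (Y ω)) ν →
      (∀ ω, G ω ≤ η → X ω ≤ η ^ q * Y ω) →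
        ∫ ω, X ω ∂ν ≤
          (∫ ω, X ω ^ (1 + ε) ∂ν) ^ (1 / (1 + ε)) * (ν {ω | η < G ω}).toReal ^ (ε / (1 + ε)) +
            η ^ ((q : ℝ) * ε / (1 + 2 * ε)) * (∫ ω, Real.sqrt (Y ω) ∂ν) ^ (2 * ε / (1 + 2 * ε)) *
              (∫ ω, X ω ^ (1 + ε) ∂ν) ^ (1 / (1 + 2 * ε)) := by
  sorry

/-- stub 2 `stub_crossingLaplace` (M, provable now; Mathlib-only): generalised Laplace expansion along the
A-rows, then along the crossing columns; flavour balance forces `≥ |q|` crossing entries. -/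
theorem stub_crossingLaplace :
    ∀ r : ℕ, ∃ K : ℝ, 0 ≤ K ∧
      ∀ (Φ : Type) [DecidableEq Φ] (M : Matrix (Fin r) (Fin r) ℂ) (φr φc : Fin r → Φ) (sr sc : Fin r → Bool)
        (f₀ : Φ) (η : ℝ), 0 ≤ η → η ≤ 1 →
        (∀ a b, φr a ≠ φc b → M a b = 0) →
        (∀ a b, sr a ≠ sc b → ‖M a b‖ ≤ η) →
          ‖M.det‖ ≤
            η ^ (((Finset.univ.filter fun a => φr a = f₀ ∧ sr a = true).card : ℤ) -
                  ((Finset.univ.filter fun b => φc b = f₀ ∧ sc b = true).card : ℤ)).natAbs * K *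
              ∑ i : Fin (r + 1), ∑ j : Fin (r + 1),
                ∑ e₁ : Fin (i : ℕ) → {a // sr a = true}, ∑ e₂ : Fin (i : ℕ) → {b // sc b = true},
                  ∑ e₃ : Fin (j : ℕ) → {a // sr a = false}, ∑ e₄ : Fin (j : ℕ) → {b // sc b = false},
                    ‖(M.submatrix (fun t => (e₁ t).1) (fun t => (e₂ t).1)).det‖ *
                      ‖(M.submatrix (fun t => (e₃ t).1) (fun t => (e₄ t).1)).det‖ := by
  sorry

/-- stub 3 `stub_apriori` (XL, HARDEST — the open core, held by the lead): `∀ Nf reg m > 0, Upper → MinorMoments`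
(r-uniform phase-quenched `(1+ε)`-moments of all Wick minors; provable corners: heavy masses, `N_f = 0`). -/
theorem stub_apriori :
    ∀ (Nf : ℕ) (reg : QCDRegularisation Nf) (m : Fin Nf → ℝ), (∀ f, 0 < m f) →
      (∃ s δ C : ℝ, 0 < s ∧ s < 1 ∧ 0 < δ ∧ ∀ᶠ k in atTop, ∀ S : ℕ, reg.L k ≤ S → ∀ (f : Fin Nf) (v : Literature.Probability.LatticeModels.Site 4), v ∈ box 4 S → (∫ U : GaugeConfig 4 (2 * S + 1) (Matrix.specialUnitaryGroup (Fin 3) ℂ), ‖(diracMatrix U fun fl => reg.mcrit k + reg.a k * m fl / reg.Zm k).det‖ * (∑ a : Fin 3, ∑ i : Fin 4, ∑ b : Fin 3, ∑ j : Fin 4, ‖(diracMatrix U fun fl => reg.mcrit k + reg.a k * m fl / reg.Zm k)⁻¹ (quarkEquiv (f, (Torus.proj (2 * S + 1) 0, a, i))) (quarkEquiv (f, (Torus.proj (2 * S + 1) (v), b, j)))‖) ^ s ∂(wilsonMeasure (fundamentalRep (Fin 3)) (reg.β k))) / (∫ U : GaugeConfig 4 (2 * S + 1) (Matrix.specialUnitaryGroup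 (Fin 3) ℂ), ‖(diracMatrix U fun fl => reg.mcrit k + reg.a k * m fl / reg.Zm k).det‖ ∂(wilsonMeasure (fundamentalRep (Fin 3)) (reg.β k))) ≤ C * Real.exp (-(δ * (reg.a k * ‖v‖)))) →
      (∃ ε : ℝ, 0 < ε ∧ ∀ r : ℕ, ∃ C : ℝ, ∀ᶠ k in atTop, ∀ S : ℕ, reg.L k ≤ S →
        ∀ I J : Fin r → QuarkVar Nf (2 * S + 1),
          Integrable (fun U : GaugeConfig 4 (2 * S + 1) SU3 =>
              ‖(Matrix.of fun a b : Fin r => (diracMatrix U fun fl => reg.mcrit k + reg.a k * m fl / reg.Zm k)⁻¹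
                (quarkEquiv (I a)) (quarkEquiv (J b))).det‖ ^ (1 + ε))
              (qcdLatticeMeasure (2 * S + 1) (reg.β k) fun fl => reg.mcrit k + reg.a k * m fl / reg.Zm k) ∧
            qcdPhaseQuenchedExpect (reg.β k) (2 * S + 1) (fun fl => reg.mcrit k + reg.a k * m fl / reg.Zm k)
                (fun U : GaugeConfig 4 (2 * S + 1) SU3 =>
                  ‖(Matrix.of fun a b : Fin r => (diracMatrix U fun fl => reg.mcrit k + reg.a k * m fl / reg.Zm k)⁻¹
                    (quarkEquiv (I a)) (quarkEquiv (J b))).det‖ ^ (1 + ε)) ≤ C) := by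
  sorry

/-- stub 4 `stub_twoPoint` (M, provable now): `∀ Nf reg m, Upper → TwoPointDecay` — torus translation
invariance of the phase-quenched measure (`wilsonMeasure_map_torusConfigShift`, `wilsonDirac_torusConfigShift`
lifted to `diracMatrix` by `Matrix.reindex`), `qcdPhaseQuenchedExpect_eq_div`, and integrability of the `s`-th
power of the entry sum (`integrable_propagatorEntrySum_qcdLatticeMeasure` + `rpow_le_one_add`; the degenerate
case `∫|det| dμ_W = 0` has `qcdLatticeMeasure = 0` and `qcdPhaseQuenchedExpect = 0`). -/
theorem stub_twoPoint :
    ∀ (Nf : ℕ) (reg : QCDRegularisation Nf) (m : Fin Nf → ℝ),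
      (∃ s δ C : ℝ, 0 < s ∧ s < 1 ∧ 0 < δ ∧ ∀ᶠ k in atTop, ∀ S : ℕ, reg.L k ≤ S → ∀ (f : Fin Nf) (v : Literature.Probability.LatticeModels.Site 4), v ∈ box 4 S → (∫ U : GaugeConfig 4 (2 * S + 1) (Matrix.specialUnitaryGroup (Fin 3) ℂ), ‖(diracMatrix U fun fl => reg.mcrit k + reg.a k * m fl / reg.Zm k).det‖ * (∑ a : Fin 3, ∑ i : Fin 4, ∑ b : Fin 3, ∑ j : Fin 4, ‖(diracMatrix U fun fl => reg.mcrit k + reg.a k * m fl / reg.Zm k)⁻¹ (quarkEquiv (f, (Torus.proj (2 * S + 1) 0, a, i))) (quarkEquiv (f, (Torus.proj (2 * S + 1) (v), b, j)))‖) ^ s ∂(wilsonMeasure (fundamentalRep (Fin 3)) (reg.β k))) / (∫ U : GaugeConfig 4 (2 * S + 1) (Matrix.specialUnitaryGroup (Fin 3) ℂ), ‖(diracMatrix U fun fl => reg.mcrit k + reg.a k * m fl / reg.Zm k).det‖ ∂(wilsonMeasure (fundamentalRep (Fin 3)) (reg.β k))) ≤ C * Real.exp (-(δ * (reg.a k *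 ‖v‖)))) →
      (∃ s δ C : ℝ, 0 < s ∧ s < 1 ∧ 0 < δ ∧ ∀ᶠ k in atTop, ∀ S : ℕ, reg.L k ≤ S →
        ∀ (f : Fin Nf) (x : TorusSite 4 (2 * S + 1)) (v : Literature.Probability.LatticeModels.Site 4), v ∈ box 4 S →
          Integrable (fun U : GaugeConfig 4 (2 * S + 1) SU3 =>
              (∑ a : Fin 3, ∑ i : Fin 4, ∑ b : Fin 3, ∑ j : Fin 4,
                ‖(diracMatrix U fun fl => reg.mcrit k + reg.a k * m fl / reg.Zm k)⁻¹ (quarkEquiv (f, (x, a, i)))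
                  (quarkEquiv (f, (x + Torus.proj (2 * S + 1) v, b, j)))‖) ^ s)
              (qcdLatticeMeasure (2 * S + 1) (reg.β k) fun fl => reg.mcrit k + reg.a k * m fl / reg.Zm k) ∧
            qcdPhaseQuenchedExpect (reg.β k) (2 * S + 1) (fun fl => reg.mcrit k + reg.a k * m fl / reg.Zm k)
                (fun U : GaugeConfig 4 (2 * S + 1) SU3 =>
                  (∑ a : Fin 3, ∑ i : Fin 4, ∑ b : Fin 3, ∑ j : Fin 4,
                    ‖(diracMatrix U fun fl => reg.mcrit k + reg.a k * m fl / reg.Zm k)⁻¹ (quarkEquiv (f, (x, a, i)))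
                      (quarkEquiv (f, (x + Torus.proj (2 * S + 1) v, b, j)))‖) ^ s) ≤
              C * Real.exp (-(δ * (reg.a k * ‖v‖)))) := by
  sorry

/-- stub 5 `stub_decayTransfer` (L — THIS idea's theorem "decay is free"):
`SplitBound → CrossingLaplace → ∀ Nf reg m, TwoPointDecay → MinorMoments → MinorDecay` with
`δ' = δ·min((1-s/2)ε/(1+ε), ε/(2+4ε))`: Markov on each crossing entry of the placed minor (entry ≤ colour–spin
block sum, `TwoPointDecay` at base site = the A-variable's site, lattice vector `v = cRep(site_B + n e₀ − site_A)`,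
`v ∈ box 4 S`, `‖v‖ ≥ n − R − R'` for `n ≤ S`), union bound `ν(Ω_n) ≤ r² η^{-s} C e^{-δ a_k (n-R-R')}`,
`CrossingLaplace` configuration-wise with `η_n = min(1, e^{-δ a_k (n-R-R')/2})` (flavour labels = `·.1`, sides =
`Sum.isLeft`, off-flavour entries of `D⁻¹` vanish: `inv_diracMatrix_apply_of_ne`, and `D⁻¹ = 0` when `det D = 0`),
`SplitBound` under the probability measure `qcdLatticeMeasure` (`isProbabilityMeasure_qcdLatticeMeasure` when
`∫|det| dμ_W > 0`; else everything is `0`), `E√Y ≤ Σ ½(E|m_A| + E|m_B|)` and the `(1+ε)`-moments from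
`MinorMoments` applied to the sub-minors (Wick minors of composed index maps; Jensen `qcdPhaseQuenchedExpect_jensen`
for first moments), finitely many `∀ᶠ` sets, `a_k → 0` (`reg.tendsto_a`) for `e^{δ' a_k (R+R')} ≤ e^{δ'(R+R')}`. -/
theorem stub_decayTransfer :
      (∀ (Ω : Type) [MeasurableSpace Ω] (ν : Measure Ω) [IsProbabilityMeasure ν] (X Y G : Ω → ℝ) (ε η : ℝ) (q : ℕ),
        0 < ε → 0 < η → η ≤ 1 → (∀ ω, 0 ≤ X ω) → (∀ ω, 0 ≤ Y ω) → Measurable X → Measurable Y → Measurable G →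
        Integrable (fun ω => X ω ^ (1 + ε)) ν → Integrable (fun ω => Real.sqrt (Y ω)) ν →
        (∀ ω, G ω ≤ η → X ω ≤ η ^ q * Y ω) →
          ∫ ω, X ω ∂ν ≤
            (∫ ω, X ω ^ (1 + ε) ∂ν) ^ (1 / (1 + ε)) * (ν {ω | η < G ω}).toReal ^ (ε / (1 + ε)) +
              η ^ ((q : ℝ) * ε / (1 + 2 * ε)) * (∫ ω, Real.sqrt (Y ω) ∂ν) ^ (2 * ε / (1 + 2 * ε)) *
                (∫ ω, X ω ^ (1 + ε) ∂ν) ^ (1 / (1 + 2 * ε))) →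
      (∀ r : ℕ, ∃ K : ℝ, 0 ≤ K ∧
        ∀ (Φ : Type) [DecidableEq Φ] (M : Matrix (Fin r) (Fin r) ℂ) (φr φc : Fin r → Φ) (sr sc : Fin r → Bool)
          (f₀ : Φ) (η : ℝ), 0 ≤ η → η ≤ 1 →
          (∀ a b, φr a ≠ φc b → M a b = 0) →
          (∀ a b, sr a ≠ sc b → ‖M a b‖ ≤ η) →
            ‖M.det‖ ≤
              η ^ (((Finset.univ.filter fun a => φr a = f₀ ∧ sr a = true).card : ℤ) -
                    ((Finset.univ.filter fun b => φc b = f₀ ∧ sc b = true).card : ℤ)).natAbs * K *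
                ∑ i : Fin (r + 1), ∑ j : Fin (r + 1),
                  ∑ e₁ : Fin (i : ℕ) → {a // sr a = true}, ∑ e₂ : Fin (i : ℕ) → {b // sc b = true},
                    ∑ e₃ : Fin (j : ℕ) → {a // sr a = false}, ∑ e₄ : Fin (j : ℕ) → {b // sc b = false},
                      ‖(M.submatrix (fun t => (e₁ t).1) (fun t => (e₂ t).1)).det‖ *
                        ‖(M.submatrix (fun t => (e₃ t).1) (fun t => (e₄ t).1)).det‖) →
    ∀ (Nf : ℕ) (reg : QCDRegularisation Nf) (m : Fin Nf → ℝ),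
      (∃ s δ C : ℝ, 0 < s ∧ s < 1 ∧ 0 < δ ∧ ∀ᶠ k in atTop, ∀ S : ℕ, reg.L k ≤ S →
        ∀ (f : Fin Nf) (x : TorusSite 4 (2 * S + 1)) (v : Literature.Probability.LatticeModels.Site 4), v ∈ box 4 S →
          Integrable (fun U : GaugeConfig 4 (2 * S + 1) SU3 =>
              (∑ a : Fin 3, ∑ i : Fin 4, ∑ b : Fin 3, ∑ j : Fin 4,
                ‖(diracMatrix U fun fl => reg.mcrit k + reg.a k * m fl / reg.Zm k)⁻¹ (quarkEquiv (f, (x, a, i)))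
                  (quarkEquiv (f, (x + Torus.proj (2 * S + 1) v, b, j)))‖) ^ s)
              (qcdLatticeMeasure (2 * S + 1) (reg.β k) fun fl => reg.mcrit k + reg.a k * m fl / reg.Zm k) ∧
            qcdPhaseQuenchedExpect (reg.β k) (2 * S + 1) (fun fl => reg.mcrit k + reg.a k * m fl / reg.Zm k)
                (fun U : GaugeConfig 4 (2 * S + 1) SU3 =>
                  (∑ a : Fin 3, ∑ i : Fin 4, ∑ b : Fin 3, ∑ j : Fin 4,
                    ‖(diracMatrix U fun fl => reg.mcrit k + reg.a k * m fl / reg.Zm k)⁻¹ (quarkEquiv (f, (x, a, i)))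
                      (quarkEquiv (f, (x + Torus.proj (2 * S + 1) v, b, j)))‖) ^ s) ≤
              C * Real.exp (-(δ * (reg.a k * ‖v‖)))) →
      (∃ ε : ℝ, 0 < ε ∧ ∀ r : ℕ, ∃ C : ℝ, ∀ᶠ k in atTop, ∀ S : ℕ, reg.L k ≤ S →
        ∀ I J : Fin r → QuarkVar Nf (2 * S + 1),
          Integrable (fun U : GaugeConfig 4 (2 * S + 1) SU3 =>
              ‖(Matrix.of fun a b : Fin r => (diracMatrix U fun fl => reg.mcrit k + reg.a k * m fl / reg.Zm k)⁻¹
                (quarkEquiv (I a)) (quarkEquiv (J b))).det‖ ^ (1 + ε))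
              (qcdLatticeMeasure (2 * S + 1) (reg.β k) fun fl => reg.mcrit k + reg.a k * m fl / reg.Zm k) ∧
            qcdPhaseQuenchedExpect (reg.β k) (2 * S + 1) (fun fl => reg.mcrit k + reg.a k * m fl / reg.Zm k)
                (fun U : GaugeConfig 4 (2 * S + 1) SU3 =>
                  ‖(Matrix.of fun a b : Fin r => (diracMatrix U fun fl => reg.mcrit k + reg.a k * m fl / reg.Zm k)⁻¹
                    (quarkEquiv (I a)) (quarkEquiv (J b))).det‖ ^ (1 + ε)) ≤ C) →
      (∃ δ' : ℝ, 0 < δ' ∧ ∀ r R R' : ℕ, ∃ C : ℝ, ∀ᶠ k in atTop, ∀ S : ℕ, reg.L k ≤ S → ∀ n : ℕ, n ≤ S →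
        ∀ (κ ρ : Fin r → BoxQuarkVar Nf R ⊕ BoxQuarkVar Nf R') (f₀ : Fin Nf),
          ((Finset.univ.filter fun a => Sum.isLeft (κ a) = true ∧
              Sum.elim (fun v : BoxQuarkVar Nf R => v.1) (fun v : BoxQuarkVar Nf R' => v.1) (κ a) = f₀).card : ℤ) -
            ((Finset.univ.filter fun b => Sum.isLeft (ρ b) = true ∧
              Sum.elim (fun v : BoxQuarkVar Nf R => v.1) (fun v : BoxQuarkVar Nf R' => v.1) (ρ b) = f₀).card : ℤ) ≠ 0 →
          Integrable (fun U : GaugeConfig 4 (2 * S + 1) SU3 =>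
              ‖(Matrix.of fun a b : Fin r => (diracMatrix U fun fl => reg.mcrit k + reg.a k * m fl / reg.Zm k)⁻¹
                (quarkEquiv (Sum.elim
                  (fun v : BoxQuarkVar Nf R =>
                    (v.1, (Torus.proj (2 * S + 1) (v.2.1 : Literature.Probability.LatticeModels.Site 4), v.2.2)))
                  (fun v : BoxQuarkVar Nf R' =>
                    (v.1, (Torus.proj (2 * S + 1)
                      ((v.2.1 : Literature.Probability.LatticeModels.Site 4) + Pi.single 0 (n : ℤ)), v.2.2)))
                  (κ a)))
                (quarkEquiv (Sum.elim
                  (fun v : BoxQuarkVar Nf R =>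
                    (v.1, (Torus.proj (2 * S + 1) (v.2.1 : Literature.Probability.LatticeModels.Site 4), v.2.2)))
                  (fun v : BoxQuarkVar Nf R' =>
                    (v.1, (Torus.proj (2 * S + 1)
                      ((v.2.1 : Literature.Probability.LatticeModels.Site 4) + Pi.single 0 (n : ℤ)), v.2.2)))
                  (ρ b)))).det‖)
              (qcdLatticeMeasure (2 * S + 1) (reg.β k) fun fl => reg.mcrit k + reg.a k * m fl / reg.Zm k) ∧
            qcdPhaseQuenchedExpect (reg.β k) (2 * S + 1) (fun fl => reg.mcrit k + reg.a k * m fl / reg.Zm k)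
                (fun U : GaugeConfig 4 (2 * S + 1) SU3 =>
                  ‖(Matrix.of fun a b : Fin r => (diracMatrix U fun fl => reg.mcrit k + reg.a k * m fl / reg.Zm k)⁻¹
                    (quarkEquiv (Sum.elim
                      (fun v : BoxQuarkVar Nf R =>
                        (v.1, (Torus.proj (2 * S + 1) (v.2.1 : Literature.Probability.LatticeModels.Site 4), v.2.2)))
                      (fun v : BoxQuarkVar Nf R' =>
                        (v.1, (Torus.proj (2 * S + 1)
                          ((v.2.1 : Literature.Probability.LatticeModels.Site 4) + Pi.single 0 (n : ℤ)), v.2.2)))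
                      (κ a)))
                    (quarkEquiv (Sum.elim
                      (fun v : BoxQuarkVar Nf R =>
                        (v.1, (Torus.proj (2 * S + 1) (v.2.1 : Literature.Probability.LatticeModels.Site 4), v.2.2)))
                      (fun v : BoxQuarkVar Nf R' =>
                        (v.1, (Torus.proj (2 * S + 1)
                          ((v.2.1 : Literature.Probability.LatticeModels.Site 4) + Pi.single 0 (n : ℤ)), v.2.2)))
                      (ρ b)))).det‖) ≤
              C * Real.exp (-(δ' * (reg.a k * n)))) := by
  sorry

/-- stub 6 `stub_wickExpansion` (L, DETERMINISTIC Grassmann bookkeeping): `∀ Nf, WickBound Nf` — expand `A.F U`,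
`B.F U` in the Grassmann monomial basis (`GrassmannAlgebra.grassmannBasis`; coefficient of `e_s` = `± berezin(F U·e_{sᶜ})`,
bounded in `U` by `QCDLatticeObservable.bounded`), `onTorus` maps monomials to products of torus generators
(`toTorusIdx`; `x + 0 = x`), `IsFlavourCharged f₀ q` + `fermiFlavourPhase_grassmannBasis` ⇒ every monomial with a
non-zero coefficient has A-charge `q ≠ 0`, Wick in determinant form (`grassmannGaussian_wick` /
`berezin_grassmannExp_quadratic_mul_prod` with `A = −D`, `fermiIntegral_fermiBoltzmann`; `#ψ̄ ≠ #ψ` ⇒ `0` by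
`berezin_grassmannExp_quadratic_mul_prod_eq_zero_of_ne`; `det D = 0` ⇒ Lean ratio `x/0 = 0`). -/
theorem stub_wickExpansion :
    ∀ Nf : ℕ,
      ∀ (R R' : ℕ) (A : QCDLatticeObservable Nf R) (B : QCDLatticeObservable Nf R') (f₀ : Fin Nf) (q : ℤ),
        q ≠ 0 → A.IsFlavourCharged f₀ q →
        ∃ (ι : Type) (_ : Fintype ι) (r : ι → ℕ) (κ : (i : ι) → Fin (r i) → BoxQuarkVar Nf R ⊕ BoxQuarkVar Nf R')
          (ρ : (i : ι) → Fin (r i) → BoxQuarkVar Nf R ⊕ BoxQuarkVar Nf R') (c : ι → ℝ),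
          (∀ i, 0 ≤ c i) ∧
          (∀ i, ((Finset.univ.filter fun a => Sum.isLeft (κ i a) = true ∧
              Sum.elim (fun v : BoxQuarkVar Nf R => v.1) (fun v : BoxQuarkVar Nf R' => v.1) (κ i a) = f₀).card : ℤ) -
            ((Finset.univ.filter fun b => Sum.isLeft (ρ i b) = true ∧
              Sum.elim (fun v : BoxQuarkVar Nf R => v.1) (fun v : BoxQuarkVar Nf R' => v.1) (ρ i b) = f₀).card : ℤ) ≠ 0) ∧
          ∀ (S n : ℕ) (mq : Fin Nf → ℝ) (U : GaugeConfig 4 (2 * S + 1) SU3),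
            ‖fermiIntegral (A.onTorus (2 * S + 1) 0 U * B.onTorus (2 * S + 1) (Pi.single 0 (n : ℤ)) U *
                  fermiBoltzmann U mq) / fermiIntegral (fermiBoltzmann U mq)‖ ≤
              ∑ i, c i * ‖(Matrix.of fun a b : Fin (r i) => (diracMatrix U mq)⁻¹
                (quarkEquiv (Sum.elim
                  (fun v : BoxQuarkVar Nf R =>
                    (v.1, (Torus.proj (2 * S + 1) (v.2.1 : Literature.Probability.LatticeModels.Site 4), v.2.2)))
                  (fun v : BoxQuarkVar Nf R' =>
                    (v.1, (Torus.proj (2 * S + 1)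
                      ((v.2.1 : Literature.Probability.LatticeModels.Site 4) + Pi.single 0 (n : ℤ)), v.2.2)))
                  (κ i a)))
                (quarkEquiv (Sum.elim
                  (fun v : BoxQuarkVar Nf R =>
                    (v.1, (Torus.proj (2 * S + 1) (v.2.1 : Literature.Probability.LatticeModels.Site 4), v.2.2)))
                  (fun v : BoxQuarkVar Nf R' =>
                    (v.1, (Torus.proj (2 * S + 1)
                      ((v.2.1 : Literature.Probability.LatticeModels.Site 4) + Pi.single 0 (n : ℤ)), v.2.2)))
                  (ρ i b)))).det‖ := by
  sorry

/-- stub 7 `stub_wickSum` (M, measure theory): `(∀ Nf, WickBound Nf) → ∀ Nf reg m, MinorDecay → Conc` with the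
SAME `δ'` — the crux's complex quotient is `qcdPhaseQuenchedExpect` (`qcdPhaseQuenchedExpect_eq_div_complex`)
`= ∫ · ∂qcdLatticeMeasure` (`qcdPhaseQuenchedExpect_eq_integral_qcdLatticeMeasure`); `norm_integral_le_of_norm_le`
with the pointwise `WickBound`, integrability and first-moment decay of each term from `MinorDecay`,
`C' = Σ_i c_i C_i`, finitely many `∀ᶠ` sets (`Filter.eventually_all`). -/
theorem stub_wickSum :
    (∀ Nf : ℕ,
      ∀ (R R' : ℕ) (A : QCDLatticeObservable Nf R) (B : QCDLatticeObservable Nf R') (f₀ : Fin Nf) (q : ℤ),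
        q ≠ 0 → A.IsFlavourCharged f₀ q →
        ∃ (ι : Type) (_ : Fintype ι) (r : ι → ℕ) (κ : (i : ι) → Fin (r i) → BoxQuarkVar Nf R ⊕ BoxQuarkVar Nf R')
          (ρ : (i : ι) → Fin (r i) → BoxQuarkVar Nf R ⊕ BoxQuarkVar Nf R') (c : ι → ℝ),
          (∀ i, 0 ≤ c i) ∧
          (∀ i, ((Finset.univ.filter fun a => Sum.isLeft (κ i a) = true ∧
              Sum.elim (fun v : BoxQuarkVar Nf R => v.1) (fun v : BoxQuarkVar Nf R' => v.1) (κ i a) = f₀).card : ℤ) -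
            ((Finset.univ.filter fun b => Sum.isLeft (ρ i b) = true ∧
              Sum.elim (fun v : BoxQuarkVar Nf R => v.1) (fun v : BoxQuarkVar Nf R' => v.1) (ρ i b) = f₀).card : ℤ) ≠ 0) ∧
          ∀ (S n : ℕ) (mq : Fin Nf → ℝ) (U : GaugeConfig 4 (2 * S + 1) SU3),
            ‖fermiIntegral (A.onTorus (2 * S + 1) 0 U * B.onTorus (2 * S + 1) (Pi.single 0 (n : ℤ)) U *
                  fermiBoltzmann U mq) / fermiIntegral (fermiBoltzmann U mq)‖ ≤
              ∑ i, c i * ‖(Matrix.of fun a b : Fin (r i) => (diracMatrix U mq)⁻¹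
                (quarkEquiv (Sum.elim
                  (fun v : BoxQuarkVar Nf R =>
                    (v.1, (Torus.proj (2 * S + 1) (v.2.1 : Literature.Probability.LatticeModels.Site 4), v.2.2)))
                  (fun v : BoxQuarkVar Nf R' =>
                    (v.1, (Torus.proj (2 * S + 1)
                      ((v.2.1 : Literature.Probability.LatticeModels.Site 4) + Pi.single 0 (n : ℤ)), v.2.2)))
                  (κ i a)))
                (quarkEquiv (Sum.elim
                  (fun v : BoxQuarkVar Nf R =>
                    (v.1, (Torus.proj (2 * S + 1) (v.2.1 : Literature.Probability.LatticeModels.Site 4), v.2.2)))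
                  (fun v : BoxQuarkVar Nf R' =>
                    (v.1, (Torus.proj (2 * S + 1)
                      ((v.2.1 : Literature.Probability.LatticeModels.Site 4) + Pi.single 0 (n : ℤ)), v.2.2)))
                  (ρ i b)))).det‖) →
    ∀ (Nf : ℕ) (reg : QCDRegularisation Nf) (m : Fin Nf → ℝ),
      (∃ δ' : ℝ, 0 < δ' ∧ ∀ r R R' : ℕ, ∃ C : ℝ, ∀ᶠ k in atTop, ∀ S : ℕ, reg.L k ≤ S → ∀ n : ℕ, n ≤ S →
        ∀ (κ ρ : Fin r → BoxQuarkVar Nf R ⊕ BoxQuarkVar Nf R') (f₀ : Fin Nf),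
          ((Finset.univ.filter fun a => Sum.isLeft (κ a) = true ∧
              Sum.elim (fun v : BoxQuarkVar Nf R => v.1) (fun v : BoxQuarkVar Nf R' => v.1) (κ a) = f₀).card : ℤ) -
            ((Finset.univ.filter fun b => Sum.isLeft (ρ b) = true ∧
              Sum.elim (fun v : BoxQuarkVar Nf R => v.1) (fun v : BoxQuarkVar Nf R' => v.1) (ρ b) = f₀).card : ℤ) ≠ 0 →
          Integrable (fun U : GaugeConfig 4 (2 * S + 1) SU3 =>
              ‖(Matrix.of fun a b : Fin r => (diracMatrix U fun fl => reg.mcrit k + reg.a k * m fl / reg.Zm k)⁻¹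
                (quarkEquiv (Sum.elim
                  (fun v : BoxQuarkVar Nf R =>
                    (v.1, (Torus.proj (2 * S + 1) (v.2.1 : Literature.Probability.LatticeModels.Site 4), v.2.2)))
                  (fun v : BoxQuarkVar Nf R' =>
                    (v.1, (Torus.proj (2 * S + 1)
                      ((v.2.1 : Literature.Probability.LatticeModels.Site 4) + Pi.single 0 (n : ℤ)), v.2.2)))
                  (κ a)))
                (quarkEquiv (Sum.elim
                  (fun v : BoxQuarkVar Nf R =>
                    (v.1, (Torus.proj (2 * S + 1) (v.2.1 : Literature.Probability.LatticeModels.Site 4), v.2.2)))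
                  (fun v : BoxQuarkVar Nf R' =>
                    (v.1, (Torus.proj (2 * S + 1)
                      ((v.2.1 : Literature.Probability.LatticeModels.Site 4) + Pi.single 0 (n : ℤ)), v.2.2)))
                  (ρ b)))).det‖)
              (qcdLatticeMeasure (2 * S + 1) (reg.β k) fun fl => reg.mcrit k + reg.a k * m fl / reg.Zm k) ∧
            qcdPhaseQuenchedExpect (reg.β k) (2 * S + 1) (fun fl => reg.mcrit k + reg.a k * m fl / reg.Zm k)
                (fun U : GaugeConfig 4 (2 * S + 1) SU3 =>
                  ‖(Matrix.of fun a b : Fin r => (diracMatrix U fun fl => reg.mcrit k + reg.a k * m fl / reg.Zm k)⁻¹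
                    (quarkEquiv (Sum.elim
                      (fun v : BoxQuarkVar Nf R =>
                        (v.1, (Torus.proj (2 * S + 1) (v.2.1 : Literature.Probability.LatticeModels.Site 4), v.2.2)))
                      (fun v : BoxQuarkVar Nf R' =>
                        (v.1, (Torus.proj (2 * S + 1)
                          ((v.2.1 : Literature.Probability.LatticeModels.Site 4) + Pi.single 0 (n : ℤ)), v.2.2)))
                      (κ a)))
                    (quarkEquiv (Sum.elim
                      (fun v : BoxQuarkVar Nf R =>
                        (v.1, (Torus.proj (2 * S + 1) (v.2.1 : Literature.Probability.LatticeModels.Site 4), v.2.2)))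
                      (fun v : BoxQuarkVar Nf R' =>
                        (v.1, (Torus.proj (2 * S + 1)
                          ((v.2.1 : Literature.Probability.LatticeModels.Site 4) + Pi.single 0 (n : ℤ)), v.2.2)))
                      (ρ b)))).det‖) ≤
              C * Real.exp (-(δ' * (reg.a k * n)))) →
      (∃ δ' : ℝ, 0 < δ' ∧ ∀ (R R' : ℕ) (A : QCDLatticeObservable Nf R) (B : QCDLatticeObservable Nf R'), (∃ (f₀ : Fin Nf) (q : ℤ), q ≠ 0 ∧ ∀ (θ : ℝ) (U : LGConfig 4 (Matrix.specialUnitaryGroup (Fin 3) ℂ)), ExteriorAlgebra.map (LinearMap.pi fun w => (Sum.elim (fun i => if (boxQuarkEquiv.symm i).1 = f₀ then Complex.exp (-((θ : ℂ) * Complex.I)) else 1) (fun i => if (boxQuarkEquiv.symm i).1 = f₀ then Complex.exp ((θ : ℂ) * Complex.I) else 1) (ofLex w)) • LinearMap.proj w) (A.F U) = Complex.exp (((q : ℝ) * θ : ℝ) * Complex.I) • A.F U) → ∃ C' : ℝ, ∀ᶠ k in atTop, ∀ S : ℕ, reg.L k ≤ S → ∀ n : ℕ, n ≤ S → ‖(∫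 U : GaugeConfig 4 (2 * S + 1) (Matrix.specialUnitaryGroup (Fin 3) ℂ), (‖(diracMatrix U fun fl => reg.mcrit k + reg.a k * m fl / reg.Zm k).det‖ : ℂ) * (fermiIntegral (A.onTorus (2 * S + 1) 0 U * B.onTorus (2 * S + 1) (Pi.single 0 (n : ℤ)) U * fermiBoltzmann U fun fl => reg.mcrit k + reg.a k * m fl / reg.Zm k) / fermiIntegral (fermiBoltzmann U fun fl => reg.mcrit k + reg.a k * m fl / reg.Zm k)) ∂(wilsonMeasure (fundamentalRep (Fin 3)) (reg.β k))) / (∫ U : GaugeConfig 4 (2 * S + 1) (Matrix.specialUnitaryGroup (Fin 3) ℂ), (‖(diracMatrix U fun fl => reg.mcrit k + reg.a k * m fl / reg.Zm k).det‖ : ℂ) ∂(wilsonMeasure (fundamentalRep (Fin 3)) (reg.β k)))‖ ≤ C' * Real.exp (-(δ' * (reg.a k * n)))) := by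
  sorry

/-! ## Wiring check: the registered stubs inhabit the obligation aliases definitionally -/

/-- The composition instantiated with the registered stubs (once every `stub_*` is proved, this very term
closes the crux). -/
theorem PhaseQuenchedFlavourDecay_of_stubs :
    Summit.QuantumFields.QCD.Theses.PauliWegnerSea.PhaseQuenchedFlavourDecay :=
  PhaseQuenchedFlavourDecay_of stub_splitBound stub_crossingLaplace stub_apriori stub_twoPoint
    stub_decayTransfer stub_wickExpansion stub_wickSum

example : Summit.QuantumFields.QCD.Theses.WilsonMobilityGap.PhaseQuenchedFlavourDecay :=
  PhaseQuenchedFlavourDecay_of_wilsonMobilityGap stub_splitBound stub_crossingLaplace stub_apriori stub_twoPoint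
    stub_decayTransfer stub_wickExpansion stub_wickSum

end Summit.QuantumFields.QCD.Cruxes.PhaseQuenchedFlavourDecay.CrossingSplitIntegrability

end
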